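import Mathlib
import Summits.Ventures.PercRepro2.Defs
import Summits.Ventures.PercRepro2.Graph
import Summits.Ventures.PercRepro2.Events
import Summits.Ventures.PercRepro2.Harris
import Summits.Ventures.PercRepro2.HCov
import Summits.Ventures.PercRepro2.PendantRoot
import Summits.Ventures.PercRepro2.PendantOB

/-!
# Leaf linearity of the covariance form: `o` or `b` a leaf at ANY vertex
(blind cell PercRepro2, mine-2 g14; MINE2-CUTVERTEX.md §13.22–§13.23, §13.25)

`Gc` is linear in the `o`-masses (`EQbo`, `EQb3o`, `PDbo`, `Do`, `EQo`, `EQ3o`) and linear in the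
`b`-masses (`EQbo`, `EQb3`, `EQb3o`, `gap`, `PDb`, `PDbo`). If the mark `v ∈ {o, b}` is a leaf
attached to an arbitrary vertex `x` by the edge `f` of weight `q = p f`, every `v`-event is
`{f open} ∩ (the same event for x)` (`PendantRoot.connEvent_other_leaf`) and `{f open}` is
independent of the `v`-free events, so every `v`-mass is `q` times the mass with `v := x`:

* `Gc_leaf_o : Gc(o leaf at x) = q · Gc(o := x)`,
* `Gc_leaf_b : Gc(b leaf at x) = q · Gc(b := x)`,

for EVERY attachment vertex `x` (marked or not; `PendantOB` / `PendantBO` are the cases `x = b` /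
`x = o`). Consequences: (HCOV) at an instance whose `o` (or `b`) is a leaf at a vertex `x` follows
from (HCOV) at the instance with the mark moved to `x` (`HCov_leaf_o_of`, `HCov_leaf_b_of`) — the
one-far-mark reduction «`o` or `b` alone behind an unmarked cut vertex» of MINE2-CUTVERTEX.md
§13.25; and at a ROOT the moved instance vanishes (the (SEP-2)/(SEP-3) zeros), at `o = b` it is
the diagonal theorem. Own exact checks: 288 / 288 random weighted instances (work/onefar.py).
-/

namespace Summit.Ventures.PercRepro2
namespace LeafLinearity

open CovForm PendantRoot

variable {V : Type*} {E : Type*} [Fintype E] [DecidableEq E] [DecidableEq V]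
  {R : Type*} [Field R] [LinearOrder R] [IsStrictOrderedRing R]

omit [DecidableEq V] [LinearOrder R] [IsStrictOrderedRing R] in
/-- `P(W ∩ {y ↔ v}) = q · P(W ∩ {y ↔ x})` for `v` a leaf at `x` and `W` free of `f`. -/
lemma prob_leaf1 (p : E → R) {ends : E → Sym2 V} {f : E} {v x : V} (hf : ends f = s(v, x))
    (hleaf : ∀ e, v ∈ ends e → e = f) (hvx : v ≠ x) {y : V} (hy : v ≠ y) {W : Set (Config E)}
    (hW : Free f W) :
    prob p (W ∩ connEvent ends y v) = p f * prob p (W ∩ connEvent ends y x) := by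
  rw [connEvent_other_leaf hf hleaf hvx hy]
  have e : W ∩ (openEdge f ∩ connEvent ends y x) = (W ∩ connEvent ends y x) ∩ openEdge f := by
    ext ω; simp only [Set.mem_inter_iff]; tauto
  rw [e, prob_inter_openEdge_of_free p (hW.inter (free_connEvent hf hleaf hvx (Ne.symm hy) (Ne.symm hvx))),
    mul_comm]

omit [DecidableEq V] [LinearOrder R] [IsStrictOrderedRing R] in
/-- `P(W ∩ ({y ↔ v} ∩ Y)) = q · P(W ∩ ({y ↔ x} ∩ Y))` for `W`, `Y` free of `f`. -/
lemma prob_leaf2 (p : E → R) {ends : E → Sym2 V} {f : E} {v x : V} (hf : ends f = s(v, x))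
    (hleaf : ∀ e, v ∈ ends e → e = f) (hvx : v ≠ x) {y : V} (hy : v ≠ y) {W Y : Set (Config E)}
    (hW : Free f W) (hY : Free f Y) :
    prob p (W ∩ (connEvent ends y v ∩ Y)) = p f * prob p (W ∩ (connEvent ends y x ∩ Y)) := by
  rw [connEvent_other_leaf hf hleaf hvx hy]
  have e : W ∩ (openEdge f ∩ connEvent ends y x ∩ Y) = (W ∩ (connEvent ends y x ∩ Y)) ∩ openEdge f := by
    ext ω; simp only [Set.mem_inter_iff]; tauto
  rw [e, prob_inter_openEdge_of_free p
    (hW.inter ((free_connEvent hf hleaf hvx (Ne.symm hy) (Ne.symm hvx)).inter hY)), mul_comm]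

omit [DecidableEq V] [LinearOrder R] [IsStrictOrderedRing R] in
/-- `P(W ∩ (Y ∩ {y ↔ v})) = q · P(W ∩ (Y ∩ {y ↔ x}))` for `W`, `Y` free of `f`. -/
lemma prob_leaf2' (p : E → R) {ends : E → Sym2 V} {f : E} {v x : V} (hf : ends f = s(v, x))
    (hleaf : ∀ e, v ∈ ends e → e = f) (hvx : v ≠ x) {y : V} (hy : v ≠ y) {W Y : Set (Config E)}
    (hW : Free f W) (hY : Free f Y) :
    prob p (W ∩ (Y ∩ connEvent ends y v)) = p f * prob p (W ∩ (Y ∩ connEvent ends y x)) := by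
  rw [connEvent_other_leaf hf hleaf hvx hy]
  have e : W ∩ (Y ∩ (openEdge f ∩ connEvent ends y x)) = (W ∩ (Y ∩ connEvent ends y x)) ∩ openEdge f := by
    ext ω; simp only [Set.mem_inter_iff]; tauto
  rw [e, prob_inter_openEdge_of_free p
    (hW.inter (hY.inter (free_connEvent hf hleaf hvx (Ne.symm hy) (Ne.symm hvx)))), mul_comm]

omit [DecidableEq V] in
/-- **`o` a leaf at any vertex `x`: `Gc = q · Gc(o := x)`.** -/
theorem Gc_leaf_o (p : E → R) (ends : E → Sym2 V) {f : E} {o x : V} (hf : ends f = s(o, x))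
    (hleaf : ∀ e, o ∈ ends e → e = f) (hox : o ≠ x) {a₁ a₂ a₃ b : V} (ho1 : o ≠ a₁) (ho2 : o ≠ a₂)
    (ho3 : o ≠ a₃) (hob : o ≠ b) :
    Gc p ends o a₁ a₂ a₃ b = p f * Gc p ends x a₁ a₂ a₃ b := by
  have c₁₂ := free_connEvent hf hleaf hox (Ne.symm ho1) (Ne.symm ho2)
  have c₂₁ := free_connEvent hf hleaf hox (Ne.symm ho2) (Ne.symm ho1)
  have c₁₃ := free_connEvent hf hleaf hox (Ne.symm ho1) (Ne.symm ho3)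
  have c₂₃ := free_connEvent hf hleaf hox (Ne.symm ho2) (Ne.symm ho3)
  have c₃₁ := free_connEvent hf hleaf hox (Ne.symm ho3) (Ne.symm ho1)
  have c₃₂ := free_connEvent hf hleaf hox (Ne.symm ho3) (Ne.symm ho2)
  have c₁b := free_connEvent hf hleaf hox (Ne.symm ho1) (Ne.symm hob)
  have c₂b := free_connEvent hf hleaf hox (Ne.symm ho2) (Ne.symm hob)
  have hQ : Free f (avoidAll ends a₂ {a₁}) := by
    rw [avoidAll_eq_compl]; exact c₁₂.compl
  have hT : Free f (TEvent ends a₁ a₂ a₃) := c₂₁.compl.inter c₂₃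
  have hTp : Free f (TEvent ends a₂ a₁ a₃) := c₁₂.compl.inter c₁₃
  have hPD : Free f (PDEvent ends a₁ a₂ a₃) :=
    c₁₂.compl.inter ((PendantOB.free_union c₃₁ c₃₂).compl)
  unfold Gc DEF CovForm.EQbo EQb3 EQb3o EQo EQ3 EQ3o PDb PDbo Do
  rw [gap_eq_Q]
  simp only [
    prob_leaf1 p hf hleaf hox ho1 hQ,
    prob_leaf2 p hf hleaf hox ho1 hQ c₁b,
    prob_leaf2 p hf hleaf hox ho1 hQ c₂b,
    prob_leaf1 p hf hleaf hox ho2 hQ,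
    prob_leaf2 p hf hleaf hox ho2 hQ c₁b,
    prob_leaf2 p hf hleaf hox ho2 hQ c₂b,
    prob_leaf1 p hf hleaf hox ho1 hPD,
    prob_leaf2 p hf hleaf hox ho1 hPD c₁b,
    prob_leaf2 p hf hleaf hox ho1 hPD c₂b,
    prob_leaf1 p hf hleaf hox ho2 hPD,
    prob_leaf2 p hf hleaf hox ho2 hPD c₁b,
    prob_leaf2 p hf hleaf hox ho2 hPD c₂b,
    prob_leaf1 p hf hleaf hox ho1 hT,
    prob_leaf2 p hf hleaf hox ho1 hT c₁b,
    prob_leaf2 p hf hleaf hox ho1 hT c₂b,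
    prob_leaf1 p hf hleaf hox ho2 hT,
    prob_leaf2 p hf hleaf hox ho2 hT c₁b,
    prob_leaf2 p hf hleaf hox ho2 hT c₂b,
    prob_leaf1 p hf hleaf hox ho1 hTp,
    prob_leaf2 p hf hleaf hox ho1 hTp c₁b,
    prob_leaf2 p hf hleaf hox ho1 hTp c₂b,
    prob_leaf1 p hf hleaf hox ho2 hTp,
    prob_leaf2 p hf hleaf hox ho2 hTp c₁b,
    prob_leaf2 p hf hleaf hox ho2 hTp c₂b]
  ring

omit [DecidableEq V] in
/-- **`b` a leaf at any vertex `x`: `Gc = q · Gc(b := x)`.** -/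
theorem Gc_leaf_b (p : E → R) (ends : E → Sym2 V) {f : E} {b x : V} (hf : ends f = s(b, x))
    (hleaf : ∀ e, b ∈ ends e → e = f) (hbx : b ≠ x) {o a₁ a₂ a₃ : V} (hbo : b ≠ o) (hb1 : b ≠ a₁)
    (hb2 : b ≠ a₂) (hb3 : b ≠ a₃) :
    Gc p ends o a₁ a₂ a₃ b = p f * Gc p ends o a₁ a₂ a₃ x := by
  have c₁₂ := free_connEvent hf hleaf hbx (Ne.symm hb1) (Ne.symm hb2)
  have c₂₁ := free_connEvent hf hleaf hbx (Ne.symm hb2) (Ne.symm hb1)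
  have c₁₃ := free_connEvent hf hleaf hbx (Ne.symm hb1) (Ne.symm hb3)
  have c₂₃ := free_connEvent hf hleaf hbx (Ne.symm hb2) (Ne.symm hb3)
  have c₃₁ := free_connEvent hf hleaf hbx (Ne.symm hb3) (Ne.symm hb1)
  have c₃₂ := free_connEvent hf hleaf hbx (Ne.symm hb3) (Ne.symm hb2)
  have c₁o := free_connEvent hf hleaf hbx (Ne.symm hb1) (Ne.symm hbo)
  have c₂o := free_connEvent hf hleaf hbx (Ne.symm hb2) (Ne.symm hbo)
  have hQ : Free f (avoidAll ends a₂ {a₁}) := by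
    rw [avoidAll_eq_compl]; exact c₁₂.compl
  have hT : Free f (TEvent ends a₁ a₂ a₃) := c₂₁.compl.inter c₂₃
  have hTp : Free f (TEvent ends a₂ a₁ a₃) := c₁₂.compl.inter c₁₃
  have hPD : Free f (PDEvent ends a₁ a₂ a₃) :=
    c₁₂.compl.inter ((PendantOB.free_union c₃₁ c₃₂).compl)
  unfold Gc DEF CovForm.EQbo EQb3 EQb3o EQo EQ3 EQ3o PDb PDbo Do
  rw [gap_eq_Q p ends a₁ a₂ b, gap_eq_Q p ends a₁ a₂ x]
  simp only [
    prob_leaf1 p hf hleaf hbx hb1 hQ,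
    prob_leaf2' p hf hleaf hbx hb1 hQ c₁o,
    prob_leaf2' p hf hleaf hbx hb1 hQ c₂o,
    prob_leaf1 p hf hleaf hbx hb2 hQ,
    prob_leaf2' p hf hleaf hbx hb2 hQ c₁o,
    prob_leaf2' p hf hleaf hbx hb2 hQ c₂o,
    prob_leaf1 p hf hleaf hbx hb1 hPD,
    prob_leaf2' p hf hleaf hbx hb1 hPD c₁o,
    prob_leaf2' p hf hleaf hbx hb1 hPD c₂o,
    prob_leaf1 p hf hleaf hbx hb2 hPD,
    prob_leaf2' p hf hleaf hbx hb2 hPD c₁o,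
    prob_leaf2' p hf hleaf hbx hb2 hPD c₂o,
    prob_leaf1 p hf hleaf hbx hb1 hT,
    prob_leaf2' p hf hleaf hbx hb1 hT c₁o,
    prob_leaf2' p hf hleaf hbx hb1 hT c₂o,
    prob_leaf1 p hf hleaf hbx hb2 hT,
    prob_leaf2' p hf hleaf hbx hb2 hT c₁o,
    prob_leaf2' p hf hleaf hbx hb2 hT c₂o,
    prob_leaf1 p hf hleaf hbx hb1 hTp,
    prob_leaf2' p hf hleaf hbx hb1 hTp c₁o,
    prob_leaf2' p hf hleaf hbx hb1 hTp c₂o,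
    prob_leaf1 p hf hleaf hbx hb2 hTp,
    prob_leaf2' p hf hleaf hbx hb2 hTp c₁o,
    prob_leaf2' p hf hleaf hbx hb2 hTp c₂o]
  ring

omit [DecidableEq V] in
/-- **(HCOV) at `o` a leaf at `x` follows from (HCOV) at `o := x`.** -/
theorem HCov_leaf_o_of (p : E → R) (hp : IsProbVec p) (ends : E → Sym2 V) {f : E} {o x : V}
    (hf : ends f = s(o, x)) (hleaf : ∀ e, o ∈ ends e → e = f) (hox : o ≠ x) {a₁ a₂ a₃ b : V}
    (ho1 : o ≠ a₁) (ho2 : o ≠ a₂) (ho3 : o ≠ a₃) (hob : o ≠ b) (h : HCov p ends x a₁ a₂ a₃ b) :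
    HCov p ends o a₁ a₂ a₃ b := by
  unfold HCov at h ⊢
  rw [Gc_leaf_o p ends hf hleaf hox ho1 ho2 ho3 hob]
  exact mul_nonneg (hp.nonneg f) h

omit [DecidableEq V] in
/-- **(HCOV) at `b` a leaf at `x` follows from (HCOV) at `b := x`.** -/
theorem HCov_leaf_b_of (p : E → R) (hp : IsProbVec p) (ends : E → Sym2 V) {f : E} {b x : V}
    (hf : ends f = s(b, x)) (hleaf : ∀ e, b ∈ ends e → e = f) (hbx : b ≠ x) {o a₁ a₂ a₃ : V}
    (hbo : b ≠ o) (hb1 : b ≠ a₁) (hb2 : b ≠ a₂) (hb3 : b ≠ a₃) (h : HCov p ends o a₁ a₂ a₃ x) :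
    HCov p ends o a₁ a₂ a₃ b := by
  unfold HCov at h ⊢
  rw [Gc_leaf_b p ends hf hleaf hbx hbo hb1 hb2 hb3]
  exact mul_nonneg (hp.nonneg f) h

end LeafLinearity
end Summit.Ventures.PercRepro2
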